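import Summits.RiemannHypothesis.RiemannHypothesis.Theses.SignCone
import Summits.RiemannHypothesis.RiemannHypothesis.Theorems.SignConeConeMagnificationCompactness
import Literature.NumberTheory.LFunctions.WeilExplicit
import Literature.NumberTheory.LFunctions.GeneralizedRH
import Summits.RiemannHypothesis.RiemannHypothesis.Theorems.SignConeConeMagnificationStubCaraWindow
import Literature.NumberTheory.LFunctions.KadiriGammaRemainder

/-!
# Stub `stub_cara` of line `Sketch` for crux `SignCone.ConeMagnification`
(item stmt-RiemannHypothesis-16303, route route-RiemannHypothesis-SignCone)

THE CARATHÉODORY DESCRIPTION OF UNIT-SLACK WEIGHTS (archive 2001 swcm "Thm A♭", necessity half). For `c ≥ 0`,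
`c 1 = 0`, with unit slack against every Weil test: `L_c(s) = Σ c(n) n^{-s}` continues as `F + 1/(s−1)` with `F`
holomorphic on `Re s > 1/2` and `Re F(s) ≤ 1/2 + Re(1/s) + 𝒜(s) − ½ log π`,
`𝒜(s) = (1/2π) ∫ Re ψ(¼ + iv/2)·(σ−½)/((σ−½)² + (t−v)²) dv` (the Poisson extension of the archimedean density).
Proof (tools in `…StubCaraWindow.lean`): glue the local continuations; for fixed `s` the window inequality for the
real bumps `g_k` of radius `1/(4(k+1))` has no finite correction, its archimedean piece is a Poisson integral
(`re_laplace_weilArchTerm_weilTranslate`); divide by the mass `m_k = ∫ G_k` and let `k → ∞` (approximate identity;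
dominated convergence `tendsto_integral_reDigamma_poisson`, majorant `(log(3+|v|) + 12)·x₀/(x₀² + (t−v)²)`).
-/

noncomputable section

-- `Summit.RiemannHypothesis.RiemannHypothesis.…` repeats a namespace component by design (D-0017 layout).
set_option linter.dupNamespace false

open scoped BigOperators ComplexConjugate Topology
open Complex MeasureTheory Set Filter

namespace Summit.RiemannHypothesis.RiemannHypothesis.Theorems.SignConeConeMagnification

open Literature.NumberTheory.LFunctions
open Summit.RiemannHypothesis.RiemannHypothesis.Theorems.SignCone

variable {g : ℝ → ℂ}

/-- **The archimedean piece as a Poisson integral.** For a Weil test `g`, `G = g ⋆ g̃` and `Re z > 0`: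
`Re ∫₀^∞ W_∞(G(· - x)) e^{-zx} dx
   = (1/2π) ∫ |ĝ(½+iv)|² Re ψ(¼ + iv/2) · Re z / ((Re z)² + (Im z - v)²) dv - log π · Re ∫₀^∞ G(-x) e^{-zx} dx`
(`(G(· - x))^(½+iv) = e^{ivx} |ĝ(½+iv)|²`, Fubini, `∫₀^∞ e^{(iv-z)x} dx = 1/(z - iv)`,
`Re 1/(z - iv) = Re z / ((Re z)² + (Im z - v)²)`). [folklore] -/
theorem re_laplace_weilArchTerm_weilTranslate (hg : IsWeilTest g) {z : ℂ} (hz : 0 < z.re) :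
    (∫ x in Ioi (0 : ℝ), weilArchTerm (weilTranslate (weilConv g (weilReflect g)) x) * cexp (-(z * x))).re =
      1 / (2 * Real.pi) * (∫ v : ℝ, ‖weilMellin g (1 / 2 + v * I)‖ ^ 2 *
          (Complex.digamma (1 / 4 + v / 2 * I)).re * (z.re / (z.re ^ 2 + (z.im - v) ^ 2))) -
        Real.log Real.pi * (∫ x in Ioi (0 : ℝ), weilConv g (weilReflect g) (-x) * cexp (-(z * x))).re := by
  set G := weilConv g (weilReflect g) with hG
  have hGt : IsWeilTest G := hg.weilConv hg.weilReflect
  obtain ⟨M, hM⟩ := hGt.1.continuous.bounded_above_of_compact_support hGt.2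
  -- the spectral weight `w(v) = |ĝ(1/2+iv)|² Re ψ(1/4 + iv/2)`, integrable and continuous
  set w : ℝ → ℝ := fun v => ‖weilMellin g (1 / 2 + v * I)‖ ^ 2 * (Complex.digamma (1 / 4 + v / 2 * I)).re
    with hw
  have hwi : Integrable w := integrable_norm_sq_weilMellin_mul_reDigammaQuarter hg
  have hwc : Continuous w :=
    (continuous_norm_sq_weilMellin_half_line hg).mul Literature.Analysis.SpecialFunctions.continuous_reDigammaQuarter
  have hW : ∀ v : ℝ, weilMellin G (1 / 2 + v * I) * ((Complex.digamma (1 / 4 + v / 2 * I)).re : ℂ) = (w v : ℂ) := by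
    intro v
    rw [hG, weilMellin_weilConv_weilReflect_half hg]
    simp only [hw]
    push_cast
    ring
  -- the two-variable integrand and Fubini
  set f : ℝ → ℝ → ℂ := fun x v => (w v : ℂ) * cexp ((v * I - z) * x) with hf
  have hfm : AEStronglyMeasurable (Function.uncurry f) ((volume.restrict (Ioi (0 : ℝ))).prod volume) := by
    refine Continuous.aestronglyMeasurable ?_
    simp only [hf, Function.uncurry_def]
    fun_prop
  have hfi : Integrable (Function.uncurry f) ((volume.restrict (Ioi (0 : ℝ))).prod volume) := by
    have hb : Integrable (fun p : ℝ × ℝ => Real.exp (-z.re * p.1) * ‖w p.2‖)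
        ((volume.restrict (Ioi (0 : ℝ))).prod volume) :=
      (exp_neg_integrableOn_Ioi 0 hz).mul_prod hwi.norm
    refine hb.mono' hfm (Eventually.of_forall fun p => le_of_eq ?_)
    show ‖(w p.2 : ℂ) * cexp ((p.2 * I - z) * p.1)‖ = Real.exp (-z.re * p.1) * ‖w p.2‖
    rw [norm_mul, Complex.norm_real, Complex.norm_exp, mul_comm]
    congr 2
    simp [sub_re, mul_re]
  have hswap := integral_integral_swap hfi
  have hinner : ∀ v : ℝ, ∫ x in Ioi (0 : ℝ), f x v = (w v : ℂ) / (z - v * I) := by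
    intro v
    have ha : ((v : ℂ) * I - z).re < 0 := by simp; exact hz
    simp only [hf]
    rw [integral_const_mul, integral_exp_mul_complex_Ioi ha 0]
    have hne : z - (v : ℂ) * I ≠ 0 := by
      intro h; have := congrArg Complex.re h; simp at this; linarith
    have hne' : (v : ℂ) * I - z ≠ 0 := by
      intro h; apply hne; linear_combination -h
    simp only [ofReal_zero, mul_zero, Complex.exp_zero]
    field_simp
    ring
  -- the archimedean term of a translate, times `e^{-zx}`
  have hfA : ∀ x : ℝ, weilArchTerm (weilTranslate G x) * cexp (-(z * x)) =
      (1 / (2 * Real.pi) : ℂ) * (∫ v, f x v) - (Real.log Real.pi : ℂ) * (G (-x) * cexp (-(z * x))) := by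
    intro x
    have e1 : weilArchIntegral (weilTranslate G x) * cexp (-(z * x)) = ∫ v, f x v := by
      rw [weilArchIntegral, ← integral_mul_const]
      congr 1 with v
      simp only [hf]
      rw [weilMellin_weilTranslate, mul_assoc (cexp _), hW v, mul_comm (cexp _), mul_assoc, ← Complex.exp_add]
      congr 2
      ring
    rw [weilArchTerm, sub_mul, mul_assoc, e1]
    simp only [weilTranslate, zero_sub]
    ring
  have hiG : IntegrableOn (fun x : ℝ => G (-x) * cexp (-(z * x))) (Ioi 0) :=
    integrableOn_mul_exp_of_bounded (hGt.1.continuous.comp continuous_neg) (C := M) (fun x _ => hM _) hz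
  have hIA : (∫ x in Ioi (0 : ℝ), weilArchTerm (weilTranslate G x) * cexp (-(z * x))) =
      (1 / (2 * Real.pi) : ℂ) * (∫ v, (w v : ℂ) / (z - v * I)) -
        (Real.log Real.pi : ℂ) * ∫ x in Ioi (0 : ℝ), G (-x) * cexp (-(z * x)) := by
    rw [setIntegral_congr_fun measurableSet_Ioi (fun x _ => hfA x), integral_sub, integral_const_mul,
      integral_const_mul]
    · congr 2
      rw [hswap]
      exact integral_congr_ae (Eventually.of_forall hinner)
    · exact (hfi.integral_prod_left).const_mul _
    · exact hiG.const_mul _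
  -- real parts
  have hJi : Integrable (fun v : ℝ => (w v : ℂ) / (z - v * I)) := by
    refine (hwi.norm.mul_const (1 / z.re)).mono' ?_ (Eventually.of_forall fun v => ?_)
    · refine (Continuous.div (by fun_prop) (by fun_prop) fun v h => ?_).aestronglyMeasurable
      have := congrArg Complex.re h; simp at this; linarith
    · rw [norm_div, Complex.norm_real, mul_one_div]
      refine div_le_div_of_nonneg_left (norm_nonneg _) hz ?_
      have h := abs_re_le_norm (z - v * I)
      have e : (z - (v : ℂ) * I).re = z.re := by simp
      rw [e, abs_of_pos hz] at h
      exact h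
  have hJre : (∫ v, (w v : ℂ) / (z - v * I)).re =
      ∫ v, w v * (z.re / (z.re ^ 2 + (z.im - v) ^ 2)) := by
    have h := integral_re hJi
    simp only [RCLike.re_to_complex] at h
    rw [← h]
    congr 1 with v
    have hn : Complex.normSq (z - v * I) = z.re ^ 2 + (z.im - v) ^ 2 := by
      rw [Complex.normSq_apply]; simp; ring
    rw [Complex.div_re, hn]
    simp
    ring
  rw [hIA, Complex.sub_re, show (1 / (2 * Real.pi) : ℂ) = ((1 / (2 * Real.pi) : ℝ) : ℂ) by push_cast; rfl,
    Complex.re_ofReal_mul, Complex.re_ofReal_mul, hJre]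

/-- **Dominated convergence for the archimedean piece.** If the normalised spectral weights
`r_k(v) = |ĝ_k(½+iv)|²/m_k ∈ [0, 1]` tend to `1` pointwise, then
`∫ r_k(v) Re ψ(¼+iv/2) x₀/(x₀² + (t-v)²) dv → ∫ Re ψ(¼+iv/2) x₀/(x₀² + (t-v)²) dv` (`x₀ > 0`), by dominated
convergence with the majorant `(log(3+|v|) + 12) x₀/(x₀² + (t-v)²)` (`KadiriGamma.abs_re_digamma_le`,
`KadiriGamma.integrable_T2_majorant`). [folklore] -/
theorem tendsto_integral_reDigamma_poisson {gs : ℕ → ℝ → ℂ} (hgs : ∀ k, IsWeilTest (gs k)) {m : ℕ → ℝ}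
    (hm : ∀ k, 0 < m k) (hle : ∀ k (v : ℝ), ‖weilMellin (gs k) (1 / 2 + v * I)‖ ^ 2 ≤ m k)
    (hlim : ∀ v : ℝ, Tendsto (fun k => ‖weilMellin (gs k) (1 / 2 + v * I)‖ ^ 2 / m k) atTop (𝓝 1))
    {x₀ : ℝ} (hx₀ : 0 < x₀) (t : ℝ) :
    Tendsto (fun k => ∫ v : ℝ, ‖weilMellin (gs k) (1 / 2 + v * I)‖ ^ 2 / m k *
        (Complex.digamma (1 / 4 + v / 2 * I)).re * (x₀ / (x₀ ^ 2 + (t - v) ^ 2))) atTop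
      (𝓝 (∫ v : ℝ, (Complex.digamma (1 / 4 + v / 2 * I)).re * (x₀ / (x₀ ^ 2 + (t - v) ^ 2)))) := by
  have hψc : Continuous fun v : ℝ => (Complex.digamma (1 / 4 + v / 2 * I)).re :=
    Literature.Analysis.SpecialFunctions.continuous_reDigammaQuarter
  have hPc : Continuous fun v : ℝ => x₀ / (x₀ ^ 2 + (t - v) ^ 2) :=
    Continuous.div continuous_const (by fun_prop) fun v => by positivity
  have hψb : ∀ v : ℝ, |(Complex.digamma (1 / 4 + v / 2 * I)).re| ≤ Real.log (3 + |v|) + 12 := by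
    intro v
    have h := KadiriGamma.abs_re_digamma_le v
    have e : ((((1 / 2 : ℝ)) : ℂ) + v * I) / 2 = 1 / 4 + v / 2 * I := by push_cast; ring
    rwa [e] at h
  refine tendsto_integral_of_dominated_convergence
    (fun v => (Real.log (3 + |v|) + 12) * (x₀ / (x₀ ^ 2 + (t - v) ^ 2))) (fun k => ?_)
    (KadiriGamma.integrable_T2_majorant hx₀ (by norm_num) hx₀.le) (fun k => Eventually.of_forall fun v => ?_)
    (Eventually.of_forall fun v => ?_)
  · exact ((((continuous_norm_sq_weilMellin_half_line (hgs k)).div_const _).mul hψc).mul hPc).aestronglyMeasurable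
  · have hP0 : 0 ≤ x₀ / (x₀ ^ 2 + (t - v) ^ 2) := by positivity
    have hr0 : 0 ≤ ‖weilMellin (gs k) (1 / 2 + v * I)‖ ^ 2 / m k := div_nonneg (by positivity) (hm k).le
    have hr1 : ‖weilMellin (gs k) (1 / 2 + v * I)‖ ^ 2 / m k ≤ 1 := (div_le_one (hm k)).2 (hle k v)
    rw [Real.norm_eq_abs, abs_mul, abs_mul, abs_of_nonneg hr0, abs_of_nonneg hP0]
    calc _ ≤ 1 * (Real.log (3 + |v|) + 12) * (x₀ / (x₀ ^ 2 + (t - v) ^ 2)) :=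
          mul_le_mul_of_nonneg_right (mul_le_mul hr1 (hψb v) (abs_nonneg _) zero_le_one) hP0
      _ = _ := by ring
  · have h := ((hlim v).mul_const ((Complex.digamma (1 / 4 + v / 2 * I)).re)).mul_const
      (x₀ / (x₀ ^ 2 + (t - v) ^ 2))
    simpa using h

/-- **Registered stub `stub_cara` of the line `Sketch`** (the Carathéodory description of the unit-slack cone,
archive 2001 swcm "Thm A♭", necessity): ONE holomorphic `F = L_c − 1/(s−1)` on `re s > 1/2` with
`Re F(s) ≤ 1/2 + Re(1/s) + 𝒜(s) − ½ log π`, `𝒜(s) = (1/2π)∫ Re ψ(1/4+iv/2)·(σ−½)/((σ−½)²+(t−v)²) dv`.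
Proof: glue the rectangles (`stub_caraGlue`); for fixed `s` apply the window inequality
(`re_mul_weilMellin_add_dslope_le`) to the real bumps `g_k` of radius `1/(4(k+1))` (no finite correction:
`finCorrection_eq_zero`), write the archimedean piece as a Poisson integral (`re_laplace_weilArchTerm_weilTranslate`),
divide by the mass `m_k = ∫ G_k` and let `k → ∞` (`tendsto_integral_mul_div`: `M_{G_k}(w)/m_k → 1`,
`dslope M_{G_k} 1 s/m_k → 0`, `𝓖_{G_k}/m_k → 1/2`; `tendsto_integral_reDigamma_poisson` for the Poisson
integrals). [folklore] -/
theorem stub_cara :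
    ∀ c : ℕ → ℝ, (∀ n, 0 ≤ c n) → c 1 = 0 →
      (∀ g : ℝ → ℂ, IsWeilTest g →
        -(∫ t, ‖g t‖ ^ 2) ≤
          (weilPolarTerm (weilConv g (weilReflect g)) + weilArchTerm (weilConv g (weilReflect g)) -
            ∑' n : ℕ, ((c n : ℝ) : ℂ) / (Real.sqrt n : ℂ) *
              (weilConv g (weilReflect g) (Real.log n) + weilConv g (weilReflect g) (-Real.log n))).re) →
      (∀ σ : ℝ, 1 < σ → LSeriesSummable (fun n => ((c n : ℝ) : ℂ)) σ) →
      (∀ s₀ : ℂ, 1 / 2 < s₀.re → ∃ η : ℝ, 0 < η ∧ ∃ F : ℂ → ℂ,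
        DifferentiableOn ℂ F {s : ℂ | 1 / 2 < s.re ∧ s.re < s₀.re + 1 ∧ s₀.im - η < s.im ∧ s.im < s₀.im + η} ∧
        ∀ s ∈ {s : ℂ | 1 / 2 < s.re ∧ s.re < s₀.re + 1 ∧ s₀.im - η < s.im ∧ s.im < s₀.im + η},
          1 < s.re → F s = LSeries (fun n => ((c n : ℝ) : ℂ)) s - 1 / (s - 1)) →
      (∀ g : ℝ → ℂ, IsWeilTest g → ∀ z : ℂ, 0 < z.re →
        0 ≤ (∫ x in Set.Ioi (0 : ℝ),
          (weilTranslate (weilConv g (weilReflect g)) x 0 +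
              weilPolarTerm (weilTranslate (weilConv g (weilReflect g)) x) +
              weilArchTerm (weilTranslate (weilConv g (weilReflect g)) x) -
              ∑' n : ℕ, ((c n : ℝ) : ℂ) / (Real.sqrt n : ℂ) *
                (weilTranslate (weilConv g (weilReflect g)) x (Real.log n) +
                  weilTranslate (weilConv g (weilReflect g)) x (-Real.log n))) *
            Complex.exp (-(z * x))).re) →
      ∃ F : ℂ → ℂ, DifferentiableOn ℂ F {s : ℂ | 1 / 2 < s.re} ∧
        (∀ s : ℂ, 1 < s.re → F s = LSeries (fun n => ((c n : ℝ) : ℂ)) s - 1 / (s - 1)) ∧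
        ∀ s : ℂ, 1 / 2 < s.re →
          (F s).re ≤ 1 / 2 + (1 / s).re +
            1 / (2 * Real.pi) * (∫ v : ℝ, (Complex.digamma (1 / 4 + v / 2 * Complex.I)).re *
              ((s.re - 1 / 2) / ((s.re - 1 / 2) ^ 2 + (s.im - v) ^ 2))) - Real.log Real.pi / 2 := by
  intro c hc hc1 hU hsum hR hPD
  obtain ⟨F, hFd, hFL⟩ := stub_caraGlue _ hR
  refine ⟨F, hFd, hFL, fun s hs => ?_⟩
  -- the point `z = s - 1/2`, `Re z > 0`
  set z : ℂ := s - 1 / 2 with hzdef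
  have hz0 : 0 < z.re := by simp [hzdef]; linarith
  have hzs : z + 1 / 2 = s := by simp [hzdef]
  have hzre : z.re = s.re - 1 / 2 := by simp [hzdef]
  have hzim : z.im = s.im := by simp [hzdef]
  -- the shrinking real bumps `g_k` of radius `ε_k = 1/(4(k+1)) ≤ 1/4`
  set ε : ℕ → ℝ := fun k => 1 / (4 * ((k : ℝ) + 1)) with hε
  have hε0 : ∀ k, 0 < ε k := fun k => by positivity
  have hε4 : ∀ k, ε k ≤ 1 / 4 := fun k => by
    show 1 / (4 * ((k : ℝ) + 1)) ≤ 1 / 4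
    exact one_div_le_one_div_of_le (by norm_num) (by nlinarith [(Nat.cast_nonneg k : (0 : ℝ) ≤ k)])
  have hεt : Tendsto (fun k => 2 * ε k) atTop (𝓝 0) := by
    have h := (tendsto_one_div_add_atTop_nhds_zero_nat (𝕜 := ℝ)).const_mul (1 / 2)
    rw [mul_zero] at h
    refine h.congr fun k => ?_
    show 1 / 2 * (1 / ((k : ℝ) + 1)) = 2 * (1 / (4 * ((k : ℝ) + 1)))
    field_simp
    norm_num
  set b : ℕ → ContDiffBump (0 : ℝ) := fun k => ⟨ε k / 2, ε k, half_pos (hε0 k), half_lt_self (hε0 k)⟩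
    with hb
  obtain ⟨G, hG⟩ : ∃ G : ℕ → ℝ → ℂ, ∀ k,
      weilConv (fun u => ((b k u : ℝ) : ℂ)) (weilReflect fun u => ((b k u : ℝ) : ℂ)) = G k := ⟨_, fun k => rfl⟩
  have hbk := fun k => weilConv_weilReflect_bump (b k)
  simp only [hG] at hbk
  have hgW : ∀ k, IsWeilTest (fun u => ((b k u : ℝ) : ℂ)) := fun k => (hbk k).1
  have hGt : ∀ k, IsWeilTest (G k) := fun k => hG k ▸ (hgW k).weilConv (hgW k).weilReflect
  have hsupp : ∀ k, tsupport (fun u => ((b k u : ℝ) : ℂ)) ⊆ Icc (-ε k) (ε k) := fun k => (hbk k).2.1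
  have hGn : ∀ k t, G k t = ((‖G k t‖ : ℝ) : ℂ) := fun k => (hbk k).2.2.1
  have hGδ : ∀ k t, 2 * ε k < |t| → G k t = 0 := fun k => (hbk k).2.2.2.1
  have hm0' : ∀ k, 0 < ∫ t, ‖G k t‖ := fun k => (hbk k).2.2.2.2
  have hGc : ∀ k, Continuous (G k) := fun k => (hGt k).1.continuous
  obtain ⟨m, hm⟩ : ∃ m : ℕ → ℝ, ∀ k, (∫ t, ‖G k t‖) = m k := ⟨_, fun k => rfl⟩
  have hm0 : ∀ k, 0 < m k := fun k => hm k ▸ hm0' k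
  -- the approximate identity for the family `G_k`
  have hAI : ∀ φ : ℝ → ℂ, Continuous φ →
      Tendsto (fun k => (∫ u, G k u * φ u) / (m k : ℂ)) atTop (𝓝 (φ 0)) := by
    intro φ hφ
    have h := tendsto_integral_mul_div hεt hGc hGδ hGn hm0' hφ
    simp only [hm] at h
    exact h
  -- (a) `M_{G_k}(w)/m_k → 1`
  have hTM : ∀ w : ℂ, Tendsto (fun k => weilMellin (G k) w / (m k : ℂ)) atTop (𝓝 1) := by
    intro w
    have h := hAI (fun u : ℝ => cexp ((w - 1 / 2) * u)) (by fun_prop)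
    simpa [weilMellin] using h
  -- (b) `dslope M_{G_k} 1 s / m_k → 0`
  have hTD : Tendsto (fun k => dslope (weilMellin (G k)) 1 s / (m k : ℂ)) atTop (𝓝 0) := by
    set φ : ℝ → ℂ := fun u => if s = 1 then (u : ℂ) * cexp ((1 - 1 / 2) * u)
      else (cexp ((s - 1 / 2) * u) - cexp ((1 - 1 / 2) * u)) / (s - 1) with hφ
    have hφc : Continuous φ := by simp only [hφ]; split_ifs <;> fun_prop
    have hφ0 : φ 0 = 0 := by simp [hφ]
    have hD : ∀ k, dslope (weilMellin (G k)) 1 s = ∫ u, G k u * φ u := by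
      intro k
      simp only [hφ]
      split_ifs with h1
      · subst h1
        rw [dslope_same, (hasDerivAt_weilMellin (hGc k) (hGt k).2 1).deriv]
      · rw [dslope_of_ne _ h1, slope_def_field]
        simp only [weilMellin]
        rw [← integral_sub (integrable_weilIntegrand (hGc k) (hGt k).2 s)
          (integrable_weilIntegrand (hGc k) (hGt k).2 1), ← integral_div]
        congr 1 with u
        ring
    have h := hAI φ hφc
    rw [hφ0] at h
    refine h.congr fun k => ?_
    rw [hD k]
  -- (c) `𝓖_{G_k}(z)/m_k → 1/2` (evenness of `G_k`)
  have hTG : Tendsto (fun k => (∫ x in Ioi (0 : ℝ), G k (-x) * cexp (-(z * x))) / (m k : ℂ)) atTop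
      (𝓝 (1 / 2)) := by
    have heven : ∀ k u, G k (-u) = G k u := fun k u => by
      have h := conj_weilConv_weilReflect_neg (fun u => ((b k u : ℝ) : ℂ)) u
      rw [hG k, hGn k (-u), Complex.conj_ofReal] at h
      rw [hGn k (-u)]
      exact h
    have hψc : Continuous fun u : ℝ => cexp (-(z * ((|u| : ℝ) : ℂ))) := by fun_prop
    have hhalf : ∀ k, (∫ x in Ioi (0 : ℝ), G k (-x) * cexp (-(z * x))) =
        (1 / 2 : ℂ) * ∫ u, G k u * cexp (-(z * ((|u| : ℝ) : ℂ))) := by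
      intro k
      have hint : Integrable (fun u : ℝ => G k u * cexp (-(z * ((|u| : ℝ) : ℂ)))) :=
        ((hGc k).mul hψc).integrable_of_hasCompactSupport (hGt k).2.mul_right
      rw [← intervalIntegral.integral_Iic_add_Ioi (b := 0) hint.integrableOn hint.integrableOn]
      have h1 : (∫ u in Ioi (0 : ℝ), G k u * cexp (-(z * ((|u| : ℝ) : ℂ)))) =
          ∫ x in Ioi (0 : ℝ), G k (-x) * cexp (-(z * x)) :=
        setIntegral_congr_fun measurableSet_Ioi fun u (hu : 0 < u) => by
          simp only [abs_of_pos hu, heven]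
      have h2 := integral_comp_neg_Ioi 0 (fun u : ℝ => G k u * cexp (-(z * ((|u| : ℝ) : ℂ))))
      simp only [neg_zero, abs_neg] at h2
      have h3 : (∫ x in Ioi (0 : ℝ), G k (-x) * cexp (-(z * ((|x| : ℝ) : ℂ)))) =
          ∫ x in Ioi (0 : ℝ), G k (-x) * cexp (-(z * x)) :=
        setIntegral_congr_fun measurableSet_Ioi fun u (hu : 0 < u) => by
          simp only [abs_of_pos hu]
      rw [← h2, h1, h3]
      ring
    have h := (hAI _ hψc).const_mul (1 / 2 : ℂ)
    simp only [abs_zero, ofReal_zero, mul_zero, neg_zero, Complex.exp_zero, mul_one] at h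
    refine h.congr fun k => ?_
    rw [hhalf k, mul_div_assoc]
  -- (d) the archimedean piece: `0 ≤ r_k ≤ 1`, `r_k → 1`, dominated convergence
  have hle : ∀ k (v : ℝ), ‖weilMellin (fun u => ((b k u : ℝ) : ℂ)) (1 / 2 + v * I)‖ ^ 2 ≤ m k := by
    intro k v
    have h1 := weilMellin_weilConv_weilReflect_half (hgW k) v
    rw [hG k] at h1
    have h2 : ‖weilMellin (G k) (1 / 2 + v * I)‖ ≤ m k := by
      rw [weilMellin, ← hm k]
      refine (norm_integral_le_integral_norm _).trans (le_of_eq ?_)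
      congr 1 with u
      rw [norm_mul, Complex.norm_exp]
      simp [mul_re]
    rw [h1, Complex.norm_real, Real.norm_of_nonneg (by positivity)] at h2
    exact h2
  have hlim : ∀ v : ℝ,
      Tendsto (fun k => ‖weilMellin (fun u => ((b k u : ℝ) : ℂ)) (1 / 2 + v * I)‖ ^ 2 / m k) atTop (𝓝 1) := by
    intro v
    have h := (Complex.continuous_re.tendsto _).comp (hTM (1 / 2 + v * I))
    simp only [Complex.one_re] at h
    refine h.congr fun k => ?_
    simp only [Function.comp_apply]
    rw [← hG k, weilMellin_weilConv_weilReflect_half (hgW k) v, Complex.div_ofReal_re, Complex.ofReal_re]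
  have hTA := tendsto_integral_reDigamma_poisson hgW hm0 hle hlim hz0 z.im
  -- the scaled window inequality for each `k`
  have hineq : ∀ k,
      (F s * (weilMellin (G k) s / (m k : ℂ))).re + (dslope (weilMellin (G k)) 1 s / (m k : ℂ)).re ≤
        (weilMellin (G k) 0 / (m k : ℂ) / s).re +
          1 / (2 * Real.pi) * (∫ v : ℝ, ‖weilMellin (fun u => ((b k u : ℝ) : ℂ)) (1 / 2 + v * I)‖ ^ 2 / m k *
            (Complex.digamma (1 / 4 + v / 2 * I)).re * (z.re / (z.re ^ 2 + (z.im - v) ^ 2))) +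
          (1 - Real.log Real.pi) * ((∫ x in Ioi (0 : ℝ), G k (-x) * cexp (-(z * x))) / (m k : ℂ)).re := by
    intro k
    have hW := re_mul_weilMellin_add_dslope_le hU hc hsum hPD hFd hFL (hgW k) (hε0 k).le (hsupp k) hz0
    rw [finCorrection_eq_zero hc1 (hε0 k).le (hε4 k), sub_zero, hzs] at hW
    have hA := re_laplace_weilArchTerm_weilTranslate (hgW k) hz0
    simp only [hG k] at hW hA
    simp only [Complex.add_re] at hW
    rw [hA] at hW
    have hmk := hm0 k
    have e1 : (F s * (weilMellin (G k) s / (m k : ℂ))).re = (F s * weilMellin (G k) s).re / m k := by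
      rw [← mul_div_assoc, Complex.div_ofReal_re]
    have e3 : (weilMellin (G k) 0 / (m k : ℂ) / s).re = (weilMellin (G k) 0 / s).re / m k := by
      rw [div_right_comm, Complex.div_ofReal_re]
    have e4 : (∫ v : ℝ, ‖weilMellin (fun u => ((b k u : ℝ) : ℂ)) (1 / 2 + v * I)‖ ^ 2 / m k *
            (Complex.digamma (1 / 4 + v / 2 * I)).re * (z.re / (z.re ^ 2 + (z.im - v) ^ 2))) =
        (∫ v : ℝ, ‖weilMellin (fun u => ((b k u : ℝ) : ℂ)) (1 / 2 + v * I)‖ ^ 2 *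
            (Complex.digamma (1 / 4 + v / 2 * I)).re * (z.re / (z.re ^ 2 + (z.im - v) ^ 2))) / m k := by
      rw [← integral_div]
      congr 1 with v
      ring
    rw [e1, Complex.div_ofReal_re, e3, e4, Complex.div_ofReal_re]
    have h := div_le_div_of_nonneg_right hW hmk.le
    refine (le_of_eq ?_).trans (h.trans (le_of_eq ?_))
    · ring
    · ring
  -- pass to the limit `k → ∞`
  have hre : ∀ {u : ℕ → ℂ} {w : ℂ}, Tendsto u atTop (𝓝 w) → Tendsto (fun k => (u k).re) atTop (𝓝 w.re) :=
    fun h => (Complex.continuous_re.tendsto _).comp h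
  have hL : Tendsto (fun k => (F s * (weilMellin (G k) s / (m k : ℂ))).re +
      (dslope (weilMellin (G k)) 1 s / (m k : ℂ)).re) atTop (𝓝 ((F s * 1).re + (0 : ℂ).re)) :=
    (hre (tendsto_const_nhds.mul (hTM s))).add (hre hTD)
  have hRl : Tendsto (fun k => (weilMellin (G k) 0 / (m k : ℂ) / s).re +
        1 / (2 * Real.pi) * (∫ v : ℝ, ‖weilMellin (fun u => ((b k u : ℝ) : ℂ)) (1 / 2 + v * I)‖ ^ 2 / m k *
          (Complex.digamma (1 / 4 + v / 2 * I)).re * (z.re / (z.re ^ 2 + (z.im - v) ^ 2))) +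
        (1 - Real.log Real.pi) * ((∫ x in Ioi (0 : ℝ), G k (-x) * cexp (-(z * x))) / (m k : ℂ)).re) atTop
      (𝓝 ((1 / s).re + 1 / (2 * Real.pi) * (∫ v : ℝ, (Complex.digamma (1 / 4 + v / 2 * I)).re *
          (z.re / (z.re ^ 2 + (z.im - v) ^ 2))) + (1 - Real.log Real.pi) * (1 / 2 : ℂ).re)) :=
    ((hre ((hTM 0).div_const s)).add (hTA.const_mul _)).add ((hre hTG).const_mul _)
  have hfin := le_of_tendsto_of_tendsto' hL hRl hineq
  simp only [mul_one, Complex.zero_re, add_zero] at hfin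
  rw [hzre, hzim] at hfin
  have h12 : (1 / 2 : ℂ).re = 1 / 2 := by simp
  rw [h12] at hfin
  linarith

end Summit.RiemannHypothesis.RiemannHypothesis.Theorems.SignConeConeMagnification

end
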